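import Summits.HubbardSuperconductivity.HubbardSuperconductivity.Theorems.LevyLogBootstrapDressHalfFilledInterHopCross
import HarnessLib

/-!
# Route `LevyLogBootstrap` / `AnisotropyChord`, crux `DressHalfFilled` (stmt-HubbardSuperconductivity-8148), stub 2
# `stub_plaquetteDictionary`, clause (d) — step 3′: a same-bond term between columns that DIFFER in the environment vanishes

Support file (`--supports stmt-HubbardSuperconductivity-8148`), companion of `…InterHopDiagTerm` (`diag_bond_term_eq`, the
same-bond term when the bond pair energies agree). Here the complementary case, with no energy hypothesis and for
arbitrary two-cluster vectors `v'`, `v` and energy `E₀`: if the columns `σ'`, `σ` differ somewhere OFF the bond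
`{R, R + e_k}`, then `⟨slice_{R,R+e_k}(ψ_σ') v', S_{H_in}(E₀) slice_{R,R+e_k}(ψ_σ) v⟩ = 0`
(`diag_bond_term_eq_zero_of_env_ne`): the reduced resolvent acts inside the ket slice
(`ClusterProductSlice.star_sliceMap_mulVec_dotProduct_reducedResolvent_sliceMap_mulVec`) and the environment overlap
`Π_{c ∉ bond} ⟨ψ_σ'(c), ψ_σ(c)⟩` vanishes (orthonormal plaquette states).

References: W.-F. Tsai, S. A. Kivelson, PRB 73 (2006) 214510, App. A (A1) [TsaiKivelson2006]. No definition and no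
named fact is introduced; all statements are [folklore].
-/

set_option linter.dupNamespace false

noncomputable section

namespace Summit.HubbardSuperconductivity.HubbardSuperconductivity.Theorems.LevyLogBootstrap

open Matrix Literature.MathematicalPhysics.QuantumLattice Literature.Probability.LatticeModels
open Literature.MathematicalPhysics.QuantumLattice.TorusPlaquette TwoCluster

variable {M : ℕ} [NeZero M]

/-- **A same-bond second-order term between columns differing in the environment vanishes** (`M ≥ 2`; any
two-cluster vectors and energy). [cite: TsaiKivelson2006, App. A (A1)] -/
theorem diag_bond_term_eq_zero_of_env_ne (hM : 2 ≤ M) (U : ℝ) (σ' σ : TensorIndex (TorusSite 2 M) 2)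
    (R : FermionTorus 2 M) (k : Fin 2) (E₀ : ℝ)
    (v' v : Finset (Orb PlaquetteSite) × Finset (Orb PlaquetteSite) → ℂ)
    (hne : ¬ ∀ c : FermionTorus 2 M, c ≠ plaqNbr R k → c ≠ R →
      σ' (FermionTorus.toTorusSite c) = σ (FermionTorus.toTorusSite c)) :
    star ((plaquettePartition M).sliceMap (plaqFamily U σ') R (plaqNbr R k) *ᵥ v') ⬝ᵥ
      (reducedResolvent (hamiltonian (fermionTorusGraph 2 (2 * M) \ SimpleGraph.comap
          (fun x : FermionTorus 2 (2 * M) => fun i : Fin 2 => ((ofLex x) i : ℕ) / 2) ⊤) 1 U) E₀ *ᵥ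
        ((plaquettePartition M).sliceMap (plaqFamily U σ) R (plaqNbr R k) *ᵥ v)) = 0 := by
  have hRN : R ≠ plaqNbr R k := (plaqNbr_ne hM R k).symm
  have hsum : hamiltonian (fermionTorusGraph 2 (2 * M) \ SimpleGraph.comap
      (fun x : FermionTorus 2 (2 * M) => fun i : Fin 2 => ((ofLex x) i : ℕ) / 2) ⊤) 1 U =
      ∑ c : FermionTorus 2 M, jwEmbed ((plaquettePartition M).emb c)
        ((fun _ : FermionTorus 2 M => plaquetteHamiltonian U) c) := by
    simpa only [plaquettePartition_emb] using hamiltonian_intra_eq_sum_jwEmbed_plaquetteHamiltonian hM U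
  have hψ : ∀ c : FermionTorus 2 M, c ≠ R → c ≠ plaqNbr R k →
      (fun _ : FermionTorus 2 M => plaquetteHamiltonian U) c *ᵥ plaqFamily U σ c =
        (((fun c : FermionTorus 2 M =>
            plaquetteEnergy U (2 * ((Fin.rev (σ (FermionTorus.toTorusSite c)) : Fin 2) : ℕ))) c : ℝ) : ℂ) •
          plaqFamily U σ c :=
    fun c _ _ => plaquetteHamiltonian_mulVec_plaquetteStates U _
  have key := (plaquettePartition M).star_sliceMap_mulVec_dotProduct_reducedResolvent_sliceMap_mulVec hRN
    (A := fun _ : FermionTorus 2 M => plaquetteHamiltonian U) (fun _ => isParityPreserving_plaquetteHamiltonian U)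
    (fun _ => plaquetteHamiltonian_isHermitian U) (LiebThm1.hamiltonian_isHermitian _ 1 U) hsum
    (plaqFamily U σ') (plaqFamily U σ) hψ E₀ v' v
  have hover : ∀ {inst : DecidableEq (FermionTorus 2 M)},
      ∏ c ∈ @Finset.erase _ inst (@Finset.erase _ inst Finset.univ R) (plaqNbr R k),
          star (plaqFamily U σ' c) ⬝ᵥ plaqFamily U σ c =
        if ∀ c : FermionTorus 2 M, c ≠ plaqNbr R k → c ≠ R →
          σ' (FermionTorus.toTorusSite c) = σ (FermionTorus.toTorusSite c) then (1 : ℂ) else 0 := by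
    intro inst
    have h1 : ∀ c, star (plaqFamily U σ' c) ⬝ᵥ plaqFamily U σ c =
        if σ' (FermionTorus.toTorusSite c) = σ (FermionTorus.toTorusSite c) then (1 : ℂ) else 0 := by
      intro c
      rw [show plaqFamily U σ' c = plaquetteStates U (σ' (FermionTorus.toTorusSite c)).rev from rfl,
        show plaqFamily U σ c = plaquetteStates U (σ (FermionTorus.toTorusSite c)).rev from rfl,
        star_plaquetteStates_dotProduct]
      by_cases hc : σ' (FermionTorus.toTorusSite c) = σ (FermionTorus.toTorusSite c)
      · rw [if_pos hc, if_pos (by rw [hc])]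
      · rw [if_neg hc, if_neg (fun h => hc (Fin.rev_injective h))]
    simp_rw [h1]
    rw [Finset.prod_boole]
    have hiff : (∀ c ∈ @Finset.erase _ inst (@Finset.erase _ inst Finset.univ R) (plaqNbr R k),
        σ' (FermionTorus.toTorusSite c) = σ (FermionTorus.toTorusSite c)) ↔
        ∀ c : FermionTorus 2 M, c ≠ plaqNbr R k → c ≠ R →
          σ' (FermionTorus.toTorusSite c) = σ (FermionTorus.toTorusSite c) := by
      refine forall_congr' fun c => ?_
      rw [Finset.mem_erase, Finset.mem_erase]
      exact ⟨fun h hN hR => h ⟨hN, hR, Finset.mem_univ c⟩, fun h hm => h hm.1 hm.2.1⟩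
    by_cases hc : ∀ c : FermionTorus 2 M, c ≠ plaqNbr R k → c ≠ R →
        σ' (FermionTorus.toTorusSite c) = σ (FermionTorus.toTorusSite c)
    · rw [if_pos hc, if_pos (hiff.2 hc)]
    · rw [if_neg hc, if_neg (fun h => hc (hiff.1 h))]
  rw [hover, if_neg hne, zero_mul] at key
  convert key using 4

end Summit.HubbardSuperconductivity.HubbardSuperconductivity.Theorems.LevyLogBootstrap

end
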